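import Summits.CriticalPhenomena.PercolationContinuityZ3.Theorems.PercNearOneGluingNoHeavyLowerTailFourPointFaceDefs
import Mathlib.Data.Real.Basic
import Mathlib.Tactic.Ring
import Mathlib.Tactic.Linarith
import Mathlib.Tactic.Positivity
import Mathlib.Tactic.NormNum
import HarnessLib

/-!
# `NoHeavyLowerTail` (stmt-CriticalPhenomena-4575) — strat-2 exact certificate `strat2_L1_suppV3` for the polarised piece (L1) on the coordinate face supp(V3) = {a|b|cy = ac|b|y = ac|by = acy|b = ab|cy = 0} ("c is joined to a or y only through b"; it contains the tight cut-vertex variety V3 = CUT:b:ay|c on which (L1) vanishes identically). Degree 4, linear multiplier, THEOREM rows only: SHK3⁺ = F0 on (a,b,c), the group row E3g = E₃(D_bc, D[ay|b], D[ay|c]) and the hybrid row E1 = E₃(D_bc, D_ac, D[ay|b]) — it REPLACES the conditional face certificate p200488 (which used the increasing-event C₃ rows #49/#66)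

Support file (prover seat `prim-e3grp-strat-2`, STRATIFIED CERTIFICATES 2 = the method-independent second certificate route;
`--supports stmt-CriticalPhenomena-4575`).  Pure algebra: no sorries, no named facts, no new definitions.  Vocabulary: prim-l12-p6's
homogeneous cell forms `CubicFourPoint.polL₁ / polL₂ / E3h / Hh` (…FourPointFaceDefs; cell order `x₀ = a|b|c|y, x₁ = a|b|cy, x₂ = a|by|c,
x₃ = a|bc|y, x₄ = ay|b|c, x₅ = ac|b|y, x₆ = ab|c|y, x₇ = a|bcy, x₈ = ay|bc, x₉ = ac|by, x₁₀ = acy|b, x₁₁ = ab|cy, x₁₂ = aby|c, x₁₃ = abc|y, x₁₄ = abcy`).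

CERTIFICATE (machine-found by this seat's OWN face/region-stratified Handelman LP over THEOREM rows only — row dictionary generated from the
partition-event semantics on `G` and on the six one-pair gluings `G/{u=v}` (= `G` with the edge `{u,v}` forced), exact reconstruction over ℚ,
two independent exact verifications; config `L1:4:1:0::1,5,9,10,11:CR`; total degree 4, multiplier degree 1, σ-power 0):
  stratum: sub-simplex with zero cells `a|b|cy`, `ac|b|y`, `ac|by`, `acy|b`, `ab|cy`;  region rows: none;
  `(L·M)(x) · σ^0 · polL₁(x) = Σ c · ROW(x) · REGION(x) · x^m`  with every `c ∈ ℕ`, 29 terms, 3 distinct rows, L·M a positive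
  integer combination of 10 monomials.
Each ROW is an instance, written in the cells (of `G` or of a gluing `G/{u=v}`, whose four-point law is the block-merge push-forward), of a TREE THEOREM:
`E3h σ …` of three pairwise separations = 3PT-LB (`…ThreePointLBSwitching`), `E3h σ …` with a group slot = hybrid/group 3PT-LB
(`HybridThreePointLB.sahiE3_hybrid_nonneg`, `GroupThreePointLB.sahiE3_groupPairSep_nonneg`), `Hh σ …` = Harris, `q·t − e₂(u)` = Aas–Gladkov; here they are
HYPOTHESES of the sign corollary (row names below = this seat's dictionary names `FAMILY[context: data]`):
  * `hr0` : `F[G:a,b,c]`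
  * `hr1` : `HYB[G:b;c;ay<ay]`
  * `hr2` : `HYB[G:c;b;a<ay]`
NOT here: the measure-level instantiation of the row hypotheses (dictionary step) and the positivity of the multiplier on realizable laws.
[cite: GladkovZimin2024HK, §4 (coordinate/terminal-edge induction behind the polarised pieces; the certificate itself is this programme's)]
-/

namespace Summit.CriticalPhenomena.PercolationContinuityZ3.Theorems

namespace CubicFourPoint

/-- **Exact certificate identity `strat2_L1_suppV3`** (strat-2; integer coefficients after clearing denominators; face cells substituted by `0`):
`(L·M)·σ^0·polL₁ = Σ c·ROW·REGION·monomial`.  Proved by `ring`. -/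
theorem strat2_L1_suppV3_identity {R : Type*} [CommRing R] (x₀ x₂ x₃ x₄ x₆ x₇ x₈ x₁₂ x₁₃ x₁₄ : R) :
    (4 * x₁₄ + 4 * x₁₃ + 2 * x₁₂ + 2 * x₈ + 2 * x₇ + 2 * x₆ + 2 * x₄ + 2 * x₃ + 2 * x₂ + 2 * x₀) * polL₁ x₀ 0 x₂ x₃ x₄ 0 x₆ x₇ x₈ 0 0 0 x₁₂ x₁₃ x₁₄
    = (E3h (x₀ + x₂ + x₃ + x₄ + x₆ + x₇ + x₈ + x₁₂ + x₁₃ + x₁₄) (x₀ + x₂ + x₄ + x₆ + x₁₂) (x₀ + x₂ + x₃ + x₄ + x₆ + x₇ + x₈ + x₁₂) (x₀ + x₂ + x₃ + x₄ + x₇ + x₈) (x₀ + x₂ + x₄ + x₆ + x₁₂) (x₀ + x₂ + x₄) (x₀ + x₂ + x₃ + x₄ + x₇ + x₈) (x₀ + x₂ + x₄)) * (4 * x₁₄ + 4 * x₁₃ + 2 * x₁₂ + 2 * x₈ + 4 * x₇ + 2 * x₆ + 2 * x₄ + 2 * x₃ + 2 * x₂ + 2 * x₀)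
      + (E3h (x₀ + x₂ + x₃ + x₄ + x₆ + x₇ + x₈ + x₁₂ + x₁₃ + x₁₄) (x₀ + x₂ + x₄ + x₆ + x₁₂) (x₀ + x₃ + x₄ + x₈) (x₀ + x₂ + x₃ + x₄ + x₆ + x₈ + x₁₂) (x₀ + x₄) (x₀ + x₂ + x₄ + x₆ + x₁₂) (x₀ + x₃ + x₄ + x₈) (x₀ + x₄)) * (2 * x₁₄ + 2 * x₁₃ + 1 * x₁₂ + 1 * x₈ + 1 * x₇ + 1 * x₆ + 1 * x₄ + 1 * x₃ + 1 * x₂ + 1 * x₀)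
      + (E3h (x₀ + x₂ + x₃ + x₄ + x₆ + x₇ + x₈ + x₁₂ + x₁₃ + x₁₄) (x₀ + x₂ + x₄ + x₆ + x₁₂) (x₀ + x₂ + x₃ + x₄ + x₆ + x₇ + x₈ + x₁₂) (x₀ + x₃ + x₄ + x₈) (x₀ + x₂ + x₄ + x₆ + x₁₂) (x₀ + x₄) (x₀ + x₃ + x₄ + x₈) (x₀ + x₄)) * (2 * x₁₄ + 2 * x₁₃ + 1 * x₁₂ + 1 * x₈ + 1 * x₆ + 1 * x₄ + 1 * x₃ + 1 * x₂ + 1 * x₀) := by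
  simp only [polL₁, hybE₁, hybE₂, E3h]
  ring

/-- **Sign corollary of `strat2_L1_suppV3`**: on the stratum (cells ≥ 0), the THEOREM rows (hypotheses `hr*`, see the file header for
which tree theorem each instantiates) give `0 ≤ (L·M)·σ^0·polL₁`. -/
theorem strat2_L1_suppV3_mul_nonneg (x₀ x₂ x₃ x₄ x₆ x₇ x₈ x₁₂ x₁₃ x₁₄ : ℝ)
    (hx₀ : 0 ≤ x₀) (hx₂ : 0 ≤ x₂) (hx₃ : 0 ≤ x₃) (hx₄ : 0 ≤ x₄) (hx₆ : 0 ≤ x₆) (hx₇ : 0 ≤ x₇) (hx₈ : 0 ≤ x₈) (hx₁₂ : 0 ≤ x₁₂) (hx₁₃ : 0 ≤ x₁₃) (hx₁₄ : 0 ≤ x₁₄)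
    (hr0 : 0 ≤ E3h (x₀ + x₂ + x₃ + x₄ + x₆ + x₇ + x₈ + x₁₂ + x₁₃ + x₁₄) (x₀ + x₂ + x₄ + x₆ + x₁₂) (x₀ + x₂ + x₃ + x₄ + x₆ + x₇ + x₈ + x₁₂) (x₀ + x₂ + x₃ + x₄ + x₇ + x₈) (x₀ + x₂ + x₄ + x₆ + x₁₂) (x₀ + x₂ + x₄) (x₀ + x₂ + x₃ + x₄ + x₇ + x₈) (x₀ + x₂ + x₄))
    (hr1 : 0 ≤ E3h (x₀ + x₂ + x₃ + x₄ + x₆ + x₇ + x₈ + x₁₂ + x₁₃ + x₁₄) (x₀ + x₂ + x₄ + x₆ + x₁₂) (x₀ + x₃ + x₄ + x₈) (x₀ + x₂ + x₃ + x₄ + x₆ + x₈ + x₁₂) (x₀ + x₄) (x₀ + x₂ + x₄ + x₆ + x₁₂) (x₀ + x₃ + x₄ + x₈) (x₀ + x₄))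
    (hr2 : 0 ≤ E3h (x₀ + x₂ + x₃ + x₄ + x₆ + x₇ + x₈ + x₁₂ + x₁₃ + x₁₄) (x₀ + x₂ + x₄ + x₆ + x₁₂) (x₀ + x₂ + x₃ + x₄ + x₆ + x₇ + x₈ + x₁₂) (x₀ + x₃ + x₄ + x₈) (x₀ + x₂ + x₄ + x₆ + x₁₂) (x₀ + x₄) (x₀ + x₃ + x₄ + x₈) (x₀ + x₄)) :
    0 ≤ (4 * x₁₄ + 4 * x₁₃ + 2 * x₁₂ + 2 * x₈ + 2 * x₇ + 2 * x₆ + 2 * x₄ + 2 * x₃ + 2 * x₂ + 2 * x₀) * polL₁ x₀ 0 x₂ x₃ x₄ 0 x₆ x₇ x₈ 0 0 0 x₁₂ x₁₃ x₁₄ := by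
  rw [strat2_L1_suppV3_identity]
  exact add_nonneg (add_nonneg (mul_nonneg (hr0) (add_nonneg (add_nonneg (add_nonneg (add_nonneg (add_nonneg (add_nonneg (add_nonneg (add_nonneg (add_nonneg (mul_nonneg ((by norm_num : (0:ℝ) ≤ 4)) hx₁₄) (mul_nonneg ((by norm_num : (0:ℝ) ≤ 4)) hx₁₃)) (mul_nonneg ((by norm_num : (0:ℝ) ≤ 2)) hx₁₂)) (mul_nonneg ((by norm_num : (0:ℝ) ≤ 2)) hx₈)) (mul_nonneg ((by norm_num : (0:ℝ) ≤ 4)) hx₇)) (mul_nonneg ((by norm_num : (0:ℝ) ≤ 2)) hx₆)) (mul_nonneg ((by norm_num : (0:ℝ) ≤ 2)) hx₄)) (mul_nonneg ((by norm_num : (0:ℝ) ≤ 2)) hx₃)) (mul_nonneg ((by norm_num : (0:ℝ) ≤ 2)) hx₂)) (mul_nonneg ((by norm_num : (0:ℝ) ≤ 2)) hx₀))) (mul_nonneg (hr1) (add_nonneg (add_nonneg (add_nonneg (add_nonneg (add_nonneg (add_nonneg (add_nonneg (add_nonneg (add_nonneg (mul_nonneg ((by norm_num : (0:ℝ) ≤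 2)) hx₁₄) (mul_nonneg ((by norm_num : (0:ℝ) ≤ 2)) hx₁₃)) (mul_nonneg ((by norm_num : (0:ℝ) ≤ 1)) hx₁₂)) (mul_nonneg ((by norm_num : (0:ℝ) ≤ 1)) hx₈)) (mul_nonneg ((by norm_num : (0:ℝ) ≤ 1)) hx₇)) (mul_nonneg ((by norm_num : (0:ℝ) ≤ 1)) hx₆)) (mul_nonneg ((by norm_num : (0:ℝ) ≤ 1)) hx₄)) (mul_nonneg ((by norm_num : (0:ℝ) ≤ 1)) hx₃)) (mul_nonneg ((by norm_num : (0:ℝ) ≤ 1)) hx₂)) (mul_nonneg ((by norm_num : (0:ℝ) ≤ 1)) hx₀)))) (mul_nonneg (hr2) (add_nonneg (add_nonneg (add_nonneg (add_nonneg (add_nonneg (add_nonneg (add_nonneg (add_nonneg (mul_nonneg ((by norm_num : (0:ℝ) ≤ 2)) hx₁₄) (mul_nonneg ((by norm_num : (0:ℝ) ≤ 2)) hx₁₃)) (mul_nonneg ((by norm_num : (0:ℝ) ≤ 1)) hx₁₂)) (mul_nonneg ((by norm_num : (0:ℝ) ≤ 1)) hx₈)) (mul_nonneg ((by norm_num :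 (0:ℝ) ≤ 1)) hx₆)) (mul_nonneg ((by norm_num : (0:ℝ) ≤ 1)) hx₄)) (mul_nonneg ((by norm_num : (0:ℝ) ≤ 1)) hx₃)) (mul_nonneg ((by norm_num : (0:ℝ) ≤ 1)) hx₂)) (mul_nonneg ((by norm_num : (0:ℝ) ≤ 1)) hx₀)))

/-- **(L1) on this stratum wherever the multiplier is positive** (it is a positive integer combination of monomials, so this is the
complement of their joint zero set): `0 < (L·M)·σ^0` together with the row hypotheses gives `0 ≤ polL₁`. -/
theorem strat2_L1_suppV3_nonneg (x₀ x₂ x₃ x₄ x₆ x₇ x₈ x₁₂ x₁₃ x₁₄ : ℝ)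
    (hx₀ : 0 ≤ x₀) (hx₂ : 0 ≤ x₂) (hx₃ : 0 ≤ x₃) (hx₄ : 0 ≤ x₄) (hx₆ : 0 ≤ x₆) (hx₇ : 0 ≤ x₇) (hx₈ : 0 ≤ x₈) (hx₁₂ : 0 ≤ x₁₂) (hx₁₃ : 0 ≤ x₁₃) (hx₁₄ : 0 ≤ x₁₄)
    (hr0 : 0 ≤ E3h (x₀ + x₂ + x₃ + x₄ + x₆ + x₇ + x₈ + x₁₂ + x₁₃ + x₁₄) (x₀ + x₂ + x₄ + x₆ + x₁₂) (x₀ + x₂ + x₃ + x₄ + x₆ + x₇ + x₈ + x₁₂) (x₀ + x₂ + x₃ + x₄ + x₇ + x₈) (x₀ + x₂ + x₄ + x₆ + x₁₂) (x₀ + x₂ + x₄) (x₀ + x₂ + x₃ + x₄ + x₇ + x₈) (x₀ + x₂ + x₄))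
    (hr1 : 0 ≤ E3h (x₀ + x₂ + x₃ + x₄ + x₆ + x₇ + x₈ + x₁₂ + x₁₃ + x₁₄) (x₀ + x₂ + x₄ + x₆ + x₁₂) (x₀ + x₃ + x₄ + x₈) (x₀ + x₂ + x₃ + x₄ + x₆ + x₈ + x₁₂) (x₀ + x₄) (x₀ + x₂ + x₄ + x₆ + x₁₂) (x₀ + x₃ + x₄ + x₈) (x₀ + x₄))
    (hr2 : 0 ≤ E3h (x₀ + x₂ + x₃ + x₄ + x₆ + x₇ + x₈ + x₁₂ + x₁₃ + x₁₄) (x₀ + x₂ + x₄ + x₆ + x₁₂) (x₀ + x₂ + x₃ + x₄ + x₆ + x₇ + x₈ + x₁₂) (x₀ + x₃ + x₄ + x₈) (x₀ + x₂ + x₄ + x₆ + x₁₂) (x₀ + x₄) (x₀ + x₃ + x₄ + x₈) (x₀ + x₄))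
    (hM : 0 < (4 * x₁₄ + 4 * x₁₃ + 2 * x₁₂ + 2 * x₈ + 2 * x₇ + 2 * x₆ + 2 * x₄ + 2 * x₃ + 2 * x₂ + 2 * x₀)) :
    0 ≤ polL₁ x₀ 0 x₂ x₃ x₄ 0 x₆ x₇ x₈ 0 0 0 x₁₂ x₁₃ x₁₄ := by
  have h := strat2_L1_suppV3_mul_nonneg x₀ x₂ x₃ x₄ x₆ x₇ x₈ x₁₂ x₁₃ x₁₄ hx₀ hx₂ hx₃ hx₄ hx₆ hx₇ hx₈ hx₁₂ hx₁₃ hx₁₄  hr0 hr1 hr2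
  exact (mul_nonneg_iff_of_pos_left hM).mp h

end CubicFourPoint

end Summit.CriticalPhenomena.PercolationContinuityZ3.Theorems
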